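import Summits.ABC.IUTFork.Joshi.ArithmeticoidProperties
import Summits.ABC.IUTFork.Joshi.ArithmeticoidPeriods
import Mathlib.RingTheory.Ideal.Quotient.Operations

/-!
# Joshi, *ATS II½ — Deformations of Number Fields* (arXiv:2305.10398) §5, co-typed remainder II: `B_L/I_y = R_y` (Thm. 5.13.1), the
# Frobenioid of an arithmeticoid (Def. 5.14.2), `Frob(arith(L)) ≃ Frob(L)^{pf}` (Prop. 5.15.1), realification (§5.16) — typed, no side taken

Sequel of `Joshi/Arithmeticoids2.lean` (seat abc-iut-E-t46, block E of the abc-iut cell, rung LADDER-ABC:A2.E; co-typer of seat abc-iut-E-t37's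
`Joshi/Arithmeticoids.lean` p430482 / `ArithmeticoidProperties.lean` p430871 / `ArithmeticoidPeriods.lean` p430897; inventory
`HOME/plan/E/t46/INVENTORY.tsv`). Same source, render and conventions: [J-2½] = K. Joshi, *Construction of Arithmetic Teichmuller Spaces II½:
Deformations of Number Fields*, unrefereed arXiv preprint 2305.10398, lit key `paper:arxiv-2305.10398`, bib `Joshi2023ATS2half`; «p.N l.M» = line M of
`HOME/plan/repair/lit/renders/Joshi-arxiv-2305.10398-ATS2half/pNNNN.txt` (PDF page N). TAKES NO SIDE on [IUTchIII] Cor. 3.12, on Joshi's claims, or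
on Mochizuki's reports on them; typed ≠ proved; typed AS A CANDIDATE ≠ endorsed; every statement print ASSERTS is a `def … : Prop` with
`@[claim "Joshi2023ATS2half" "disputed"]`, never an axiom / instance / theorem; what FOLLOWS from the typed signatures is a `theorem` (DISCHARGED).
E-t37's carriers (`DeformationDatum`, `Arith`, `arithRing`, `iota`, `logCoords`, `valueGroup`, `Prop483`, `IsDef411`, `IsDef481`, `ord`,
`BRingDatum.BL`, `PhiL`) are imported BY NAME; nothing of theirs is restated.

CONTENTS (node ids of `HOME/plan/E/JOSHI-DAG.tsv`):
* J2h:Thm5.13.1 — the RESIDUE SIGNATURE `ResidueDatum` (the surjections `η_{y_v} : B_{L_v} ↠ K_{y_v}` with closed kernels `𝔪_{y_v}` of [FF18] that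
  the proof uses) over E-t37's `BRingDatum`; `etaPi`, `Iy`, `mem_Iy_iff` (`I_y = ∏_v 𝔪_{y_v}`), `isClosed_Iy`, `ker_eta_isMaximal`,
  `thm5131 : B_L ⧸ I_y ≃+* R_y` — all DERIVED over that signature.
* J2h:Def5.14.2 `logValueGroup` (the value group `K_v*/𝒪*_{K_v}` in log-coordinates, group structure DERIVED), `PhiArith` = `Φ(arith(L))`,
  `PhiArithGp`, `divArith` (`L* → Φ(arith(L))^gp`, = `−logCoords` of p430897) with `divArith_mem` / `divArith_mul` DERIVED; J2h:Rmk5.14.4 /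
  J2h:Rmk5.14.5 docstring.
* J2h:Prop5.15.1 `PhiLpf`, `PhiLgpPf` (the perfection `Φ(L)^{pf} = ⊕_{v ∉ V^arc} ℚ_{≥0}` of E-t37's `PhiL`) and the claim `Prop5151`.
* §5.16 / J2h:Rmk5.16.1 `logValueGroup_eq_top_of_prop483` (DERIVED modulo E-t37's claim `Prop483`: on `𝒴^ℝ_L` the Frobenioid of an arithmeticoid
  is its own realification) + docstring.
* v2 ERRATUM (same seat, minutes after v1 landed, no importers): `Prop5151` (v1) typed Prop. 5.15.1 as an ABSTRACT group isomorphism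
  `Φ(arith)^gp ≃ (Φ(L)^{pf})^gp` over ALL places with zero archimedean coordinates on the `Φ(L)` side — unsatisfiable for artefact
  reasons whenever an archimedean value group is uncountable, hence NOT a faithful reading; it is kept (append-only tree) and DEPRECATED in
  favour of `Prop5151v2` = print's «natural isomorphism» read coordinatewise at `v ∉ V^arc` inside `ℝ` (the value group of `K_{y_v}` is the
  perfection = divisible hull of that of `L_v`), concordant with seat E-t37's handed-over draft; + `log_absK_emb_mem` (DERIVED).
OUR SIDE: nothing here mentions the Cor. 3.12 vocabulary (E-PLAN R14). Nearest typed objects (docstrings only): [J-III] §10's later version of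
these Frobenioids is typed in seat E-t32's `Joshi/FrobenioidsJoshi.lean` (p430621) and seat E-t34's `Joshi/FrobenioidsJoshiGlobal.lean` (p431166);
E-t37's `PhiL` / `divL` (Def. 5.14.1, p430897) is the `Frob(L)` compared with here.
-/

noncomputable section

open TopologicalSpace

namespace Summit.ABC.IUTFork.Joshi.ATS2h

namespace DeformationDatum

variable {L : Type} [Field L] {V : Type} {Lv : V → Type} [∀ v, Field (Lv v)] {Y : V → Type}
  [∀ v, TopologicalSpace (Y v)] {K : (v : V) → Y v → Type} [∀ v y, Field (K v y)] [∀ v y, TopologicalSpace (K v y)]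
  {G : V → Type} [∀ v, Group (G v)] {A : V → Type} [∀ v, Group (A v)]
  (D : DeformationDatum L V Lv Y K G A)

/-! ## §5.13 Deformations of a number field are linked by `B_L` (Thm. 5.13.1) -/

/-- **RESIDUE SIGNATURE for [J-2½] Thm. 5.13.1** (HYPOTHESIS structure over E-t37's `BRingDatum`, nothing asserted): the facts of [FF18] the
proof (p.41 l.10–31) uses — «for each `v ∈ V_L`, let `𝔪_{y,v} ⊂ B_{L̂_v,L_v}` be the closed maximal ideal corresponding to the (closed classical)
point `y_v ∈ Y_{L̂^♭_v,L_v}`» with residue field `K_{y,v}`: a continuous surjection `η_{y_v} : B_{L_v} ↠ K_{y_v}` with closed kernel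
`𝔪_{y_v}` (maximality is DERIVED, `ker_eta_isMaximal`). [claim: Joshi2023ATS2half, status: disputed] -/
structure ResidueDatum {B : V → Type} [∀ v, CommRing (B v)] [∀ v, TopologicalSpace (B v)] [∀ v, Algebra (Lv v) (B v)]
    (R : D.BRingDatum B) : Type where
  /-- `η_{y_v} : B_{L_v} → K_{y_v}`, reduction modulo `𝔪_{y_v}` -/
  eta : (v : V) → (y : Y v) → B v →+* K v y
  /-- `η_{y_v}` is onto (`B_{L_v}/𝔪_{y_v} = K_{y_v}`) -/
  eta_surjective : ∀ v y, Function.Surjective (eta v y)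
  /-- `η_{y_v}` is continuous -/
  continuous_eta : ∀ v y, Continuous (eta v y)
  /-- `𝔪_{y_v} = ker η_{y_v}` is closed («the closed maximal ideal») -/
  isClosed_ker : ∀ v y, IsClosed (RingHom.ker (eta v y) : Set (B v))

namespace ResidueDatum

variable {D} {B : V → Type} [∀ v, CommRing (B v)] [∀ v, TopologicalSpace (B v)] [∀ v, Algebra (Lv v) (B v)]
  {R : D.BRingDatum B} (E : D.ResidueDatum R)

/-- `𝔪_{y_v}` is a maximal ideal (kernel of a surjection onto a field). DERIVED. [folklore] -/
theorem ker_eta_isMaximal (v : V) (y : Y v) : (RingHom.ker (E.eta v y)).IsMaximal :=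
  RingHom.ker_isMaximal_of_surjective _ (E.eta_surjective v y)

/-- The product surjection `B_L = ∏_v B_{L_v} → ∏_v K_{y,v} = R_y` of the proof (p.41 l.20–31), «given on the factor corresponding to `v` by
quotienting by the maximal ideal `𝔪_{y,v}`». [claim: Joshi2023ATS2half, status: disputed] -/
def etaPi (y : D.Arith) : R.BL →+* D.arithRing y := RingHom.pi fun v => (E.eta v (y v)).comp (Pi.evalRingHom B v)

/-- `etaPi` is coordinatewise. [claim: Joshi2023ATS2half, status: disputed] -/
@[simp] theorem etaPi_apply (y : D.Arith) (b : R.BL) (v : V) : E.etaPi y b v = E.eta v (y v) (b v) := rfl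

/-- The product surjection is onto. DERIVED. [folklore] -/
theorem etaPi_surjective (y : D.Arith) : Function.Surjective (E.etaPi y) := fun r =>
  ⟨fun v => Classical.choose (E.eta_surjective v (y v) (r v)), funext fun v => Classical.choose_spec (E.eta_surjective v (y v) (r v))⟩

/-- **[J-2½] Thm. 5.13.1, the ideal `I_y`** (p.41 l.15–19: «the product ideal `I_y = ∏_{v ∈ V_L} 𝔪_{y_v}`», l.30–31: «The kernel of this
surjection is `I_y`») — typed as the kernel. [claim: Joshi2023ATS2half, status: disputed] -/
def Iy (y : D.Arith) : Ideal R.BL := RingHom.ker (E.etaPi y)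

/-- `I_y = ∏_v 𝔪_{y_v}`: membership is coordinatewise membership in the kernels. DERIVED. [claim: Joshi2023ATS2half, status: disputed] -/
theorem mem_Iy_iff (y : D.Arith) (b : R.BL) : b ∈ E.Iy y ↔ ∀ v, b v ∈ RingHom.ker (E.eta v (y v)) := by
  simp only [Iy, RingHom.mem_ker, funext_iff, etaPi_apply, Pi.zero_apply]

/-- **[J-2½] Thm. 5.13.1, «closed»** (p.41 l.8, l.19–20: «is closed in product topology on `B_L`») DERIVED: `I_y` is the intersection of the
preimages of the closed `𝔪_{y_v}` under the (continuous) coordinate projections. [claim: Joshi2023ATS2half, status: disputed] -/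
theorem isClosed_Iy (y : D.Arith) : IsClosed (E.Iy y : Set R.BL) := by
  have : (E.Iy y : Set R.BL) = ⋂ v, (fun b : R.BL => b v) ⁻¹' (RingHom.ker (E.eta v (y v)) : Set (B v)) := by
    ext b
    simp [E.mem_Iy_iff y b]
  rw [this]
  exact isClosed_iInter fun v => (E.isClosed_ker v (y v)).preimage (continuous_apply v)

/-- **[J-2½] Thm. 5.13.1** (p.41 l.7–9) DERIVED over the residue signature: «Let `arith(L)_y` be an arithmeticoid. Let `R_y` be its arithmetic
ring. Then there exists a closed ideal `I_y ⊂ B_L` such that `B_L/I_y = R_y`» — the first isomorphism theorem for the product surjection.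
[claim: Joshi2023ATS2half, status: disputed] -/
def thm5131 (y : D.Arith) : R.BL ⧸ E.Iy y ≃+* D.arithRing y := RingHom.quotientKerEquivOfSurjective (E.etaPi_surjective y)

end ResidueDatum

/-! ## §5.14 The Frobenioid of an arithmeticoid (Def. 5.14.2); §5.15 `Frob(arith(L)) ≃ Frob(L)^{pf}` (Prop. 5.15.1); §5.16 realification -/

/-- The value group `K_{y_v}*/𝒪*_{K_{y_v}} = |K_{y_v}*| ⊂ ℝ_{>0}` of Def. 5.14.2 in LOGARITHMIC coordinates — `{log|x|_{K_{y_v}} : x ∈ K*}` as an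
additive subgroup of `ℝ` (p.42 l.18–22: «`K_v*/𝒪*_{K_v}` is the value group of `K_v` and by [Scholze, 2012] this value group is naturally
isomorphic to the value group of its tilt»); the group structure is DERIVED from the multiplicativity of `|−|_{K}` (§2.3).
[claim: Joshi2023ATS2half, status: disputed] -/
def logValueGroup (y : D.Arith) (v : V) : AddSubgroup ℝ where
  carrier := {r | ∃ x : (K v (y v))ˣ, Real.log (D.absK v (y v) x) = r}
  add_mem' := by
    rintro _ _ ⟨x, rfl⟩ ⟨x', rfl⟩
    refine ⟨x * x', ?_⟩
    rw [Units.val_mul, (D.absK_isValuedField v (y v)).map_mul,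
      Real.log_mul ((D.absK_isValuedField v (y v)).pos_of_ne_zero x.ne_zero).ne'
        ((D.absK_isValuedField v (y v)).pos_of_ne_zero x'.ne_zero).ne']
  zero_mem' := ⟨1, by rw [Units.val_one, (D.absK_isValuedField v (y v)).map_one, Real.log_one]⟩
  neg_mem' := by
    rintro _ ⟨x, rfl⟩
    exact ⟨x⁻¹, by rw [Units.val_inv_eq_inv_val, (D.absK_isValuedField v (y v)).map_inv, Real.log_inv]⟩

/-- **[J-2½] Def. 5.14.2, `Φ(arith(L))`** (p.42 l.1–8): «`Φ(arith(L)) = ⊕_{v ∈ V_L} (𝒪^⊳_{K_v})/𝒪*_{K_v}`» (`R^⊳` = «the multiplicative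
monoid of non-zero elements», p.41 l.32–33) — in log-coordinates the finitely supported vectors whose `v`-coordinate is `−log|x_v|_{K_v} ≥ 0`
for some `x_v ≠ 0` (sign convention of E-t37's `PhiL`: integral = nonnegative; LOCATED as there: print's sum runs over ALL `v ∈ V_L`, here
included — for an archimedean `K_v` the monoid `{0 < |z| ≤ 1}/{|z| = 1}` makes sense). Rmk. 5.14.4 (p.42 l.23–26): «The data of a Frobenioid
of a number field is much weaker than the data of an arithmeticoid»; Rmk. 5.14.5 (p.42 l.27–29): a Frobenioid «associated to any
quasi-projective variety … This remark will not be used in this paper». [claim: Joshi2023ATS2half, status: disputed] -/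
def PhiArith (y : D.Arith) : AddSubmonoid (V →₀ ℝ) where
  carrier := {f | ∀ v, f v ∈ D.logValueGroup y v ∧ 0 ≤ f v}
  add_mem' hf hg := fun v => ⟨by simpa using add_mem (hf v).1 (hg v).1, by simpa using add_nonneg (hf v).2 (hg v).2⟩
  zero_mem' := fun v => ⟨zero_mem _, le_rfl⟩

/-- **[J-2½] Def. 5.14.2, `Φ(arith(L))^gp`** (p.42 l.9–15): `⊕_v K_v*/𝒪*_{K_v}` in log-coordinates. [claim: Joshi2023ATS2half, status: disputed] -/
def PhiArithGp (y : D.Arith) : AddSubgroup (V →₀ ℝ) where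
  carrier := {f | ∀ v, f v ∈ D.logValueGroup y v}
  add_mem' hf hg := fun v => by simpa using add_mem (hf v) (hg v)
  zero_mem' := fun v => zero_mem _
  neg_mem' hf := fun v => by simpa using neg_mem (hf v)

/-- `Φ(arith(L)) ⊂ Φ(arith(L))^gp`. [folklore] -/
theorem phiArith_le_phiArithGp (y : D.Arith) {f : V →₀ ℝ} (hf : f ∈ D.PhiArith y) : f ∈ D.PhiArithGp y := fun v => (hf v).1

/-- **[J-2½] Def. 5.14.2, the map `L* → Φ(arith(L))^gp`** (p.42 l.9–15: «the natural homomorphism given in the `v` component by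
`x ↦ ι_{L_v}(x) mod 𝒪*_{K_v} ∈ K_v*/𝒪*_{K_v}`»): in log-coordinates `x ↦ (−log|ι_{y_v}(x)|_{K_{y_v}})_v` — minus E-t37's `logCoords`
(finitely supported by the product formula). `Frob(arith(L)) := (L*, Φ(arith(L)), L* → Φ(arith(L))^gp)` (5.14.3) is the triple
(`Lˣ`, `PhiArith y`, `divArith y`). [claim: Joshi2023ATS2half, status: disputed] -/
def divArith (y : D.Arith) (x : Lˣ) : V →₀ ℝ := -D.logCoords y x

/-- Coordinates of `divArith`. [claim: Joshi2023ATS2half, status: disputed] -/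
@[simp] theorem divArith_apply (y : D.Arith) (x : Lˣ) (v : V) : D.divArith y x v = -Real.log (D.absK v (y v) (D.iota y v x)) := by
  simp [divArith]

/-- `L* → Φ(arith(L))^gp` lands in `Φ(arith(L))^gp`. DERIVED. [claim: Joshi2023ATS2half, status: disputed] -/
theorem divArith_mem (y : D.Arith) (x : Lˣ) : D.divArith y x ∈ D.PhiArithGp y := fun v => by
  rw [divArith_apply]
  exact neg_mem ⟨Units.mk0 _ (D.iota_ne_zero y v x), rfl⟩

/-- `L* → Φ(arith(L))^gp` is a homomorphism («the natural homomorphism»). DERIVED. [claim: Joshi2023ATS2half, status: disputed] -/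
theorem divArith_mul (y : D.Arith) (x x' : Lˣ) : D.divArith y (x * x') = D.divArith y x + D.divArith y x' := by
  ext v
  simp only [divArith_apply, Finsupp.add_apply, Units.val_mul, map_mul, (D.absK_isValuedField v (y v)).map_mul]
  rw [Real.log_mul (D.absK_iota_pos y v x).ne' (D.absK_iota_pos y v x').ne', neg_add]

/-- **[J-2½] Prop. 5.15.1's `Φ(L)^{pf}`** (p.42 l.36–51: «the perfection `Frob(L)^{pf}` replaces `Φ(L)` by its perfection `Φ(L)^{pf}`»): the
perfection of E-t37's `PhiL = ⊕_{v ∉ V^arc} (𝒪^⊳_{L_v})/𝒪*_{L_v} ≅ ⊕ ℕ` is `⊕_{v ∉ V^arc} ℚ_{≥0}` (finitely supported nonnegative rational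
vectors vanishing on `V^arc`). [claim: Joshi2023ATS2half, status: disputed] -/
def PhiLpf : AddSubmonoid (V →₀ ℚ) where
  carrier := {f | (∀ v, 0 ≤ f v) ∧ ∀ v, v ∈ D.Varc → f v = 0}
  add_mem' hf hg := ⟨fun v => by simpa using add_nonneg (hf.1 v) (hg.1 v), fun v hv => by simp [hf.2 v hv, hg.2 v hv]⟩
  zero_mem' := ⟨fun _ => le_rfl, fun _ _ => rfl⟩

/-- `(Φ(L)^{pf})^gp = ⊕_{v ∉ V^arc} ℚ`. [claim: Joshi2023ATS2half, status: disputed] -/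
def PhiLgpPf : AddSubgroup (V →₀ ℚ) where
  carrier := {f | ∀ v, v ∈ D.Varc → f v = 0}
  add_mem' hf hg := fun v hv => by simp [hf v hv, hg v hv]
  zero_mem' := fun _ _ => rfl
  neg_mem' hf := fun v hv => by simp [hf v hv]

/-- **[J-2½] Prop. 5.15.1** (p.42 l.31–51): «Let `arith(L)` be an arithmeticoid of a number field `L` [`y ∈ 𝒴_L`, Def. 5.1.1]. Then there is a
natural isomorphism `Frob(arith(L)) ≃ Frob(L)^{pf}` of Frobenioids, where `Frob(arith(L)) = (L*, Φ(arith(L)), L* → Φ(arith(L))^gp)` … and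
the perfection of the Frobenioid of the number field `L` defined by Mochizuki in [Mochizuki, 2008, Example 6.3] … `Frob(L)^{pf} = (L*,
Φ(L)^{pf} …, L* → (Φ(L)^{pf})^gp)`. On the other hand many non-isomorphic arithmeticoids of `L` provide isomorphic Frobenioids isomorphic to
`Frob(L)^{pf}`. Proof. The proof is immediate from the definitions.» Typed for Def. 4.1.1's `𝒴_L`: an isomorphism of the groups
`Φ(arith(L)_y)^gp ≃ (Φ(L)^{pf})^gp` carrying the monoid `Φ(arith(L)_y)` onto `Φ(L)^{pf}` and `L* → Φ(arith)^gp` (`divArith`) to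
`L* → (Φ(L)^{pf})^gp` (E-t37's `divL = (ord_v)_v`, Def. 5.14.1). [claim: Joshi2023ATS2half, status: disputed] -/
@[claim "Joshi2023ATS2half" "disputed"]
def Prop5151 : Prop :=
  D.IsDef411 → ∀ y : D.Arith, ∃ e : D.PhiArithGp y ≃+ D.PhiLgpPf,
    (∀ f : D.PhiArithGp y, (f : V →₀ ℝ) ∈ D.PhiArith y ↔ (e f : V →₀ ℚ) ∈ D.PhiLpf) ∧
      ∀ (x : Lˣ) (v : V), (e ⟨D.divArith y x, D.divArith_mem y x⟩ : V →₀ ℚ) v = ((Multiplicative.toAdd (D.ord v x) : ℤ) : ℚ)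

/-- **[J-2½] §5.16** (p.43 l.1–13) DERIVED modulo E-t37's claim `Prop483` (Prop. 4.8.3 (2): on `𝒴^ℝ_L` «the value group of `K_{y_v}` is equal
to `ℝ`»): «the value group of an algebraically closed perfectoid field is rank one i.e. naturally given by specifying a valuation taking
values in `ℝ`. So one can view the Frobenioid of `Frob(arith(L))` as equipped with a natural realification `Frob(arith(L))^ℝ` … By the
construction of `𝒴^ℝ_L` in § 4.8, if `y ∈ 𝒴^ℝ_L` then `Frob(arith(L)_y)` natural[ly] equals its realification … `Frob(arith(L)_y) =
Frob(arith(L)_y)^ℝ`» — in log-coordinates: every `Φ(arith(L)_y)^gp_v` is all of `ℝ`. Rmk. 5.16.1 (p.43 l.14–24): «perfections of the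
Frobenioids of `p`-adic fields in [Mochizuki, 2021a,b,c,d] are a proxy for (algebraically closed) perfectoid fields … Notably Mochizuki's
Hodge-Theaters requires the notion of arithmeticoids of number fields rather than the realification of Frobenioids of number fields» —
recorded, no adjudication. [claim: Joshi2023ATS2half, status: disputed] -/
theorem logValueGroup_eq_top_of_prop483 (h483 : D.Prop483) (h : D.IsDef481) (y : D.Arith) (v : V) : D.logValueGroup y v = ⊤ := by
  refine (AddSubgroup.eq_top_iff' _).2 fun r => ?_
  have hvg := (h483 h y v).2.2.1
  have hr : Real.exp r ∈ D.valueGroup v (y v) := by rw [hvg]; exact Real.exp_pos r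
  obtain ⟨x, hx, hxr⟩ := hr
  exact ⟨Units.mk0 x hx, by rw [Units.val_mk0, hxr, Real.log_exp]⟩

/-- `log|ι_{y_v}(x)|_{K_{y_v}} ∈ Φ(arith(L))^gp_v` for `x ∈ L_v*`: the value group of `L_v`, read inside `K_{y_v}`, sits in that of `K_{y_v}`
(the `q = 1` instances of `Prop5151v2`'s right-hand side). DERIVED. [folklore] -/
theorem log_absK_emb_mem (y : D.Arith) (v : V) (x : (Lv v)ˣ) :
    Real.log (D.absK v (y v) (D.emb v (y v) (x : Lv v))) ∈ D.logValueGroup y v :=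
  ⟨Units.mk0 _ ((map_ne_zero_iff _ (D.emb v (y v)).injective).2 x.ne_zero), rfl⟩

/-- **[J-2½] Prop. 5.15.1, v2 (ERRATUM to `Prop5151` above)** (p.42 l.31–51): «there is a natural isomorphism `Frob(arith(L)) ≃ Frob(L)^{pf}`
of Frobenioids … The perfection `Frob(L)^{pf}` replaces `Φ(L)` by its perfection `Φ(L)^{pf}`» — typed for Def. 4.1.1's `𝒴_L`, coordinatewise
at `v ∉ V^arc` (where E-t37's `PhiL` = `Φ(L)` lives, Def. 5.14.1): the identity of `L*` together with, inside `ℝ`, the EQUALITY of the value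
group `K_{y_v}*/𝒪*_{K_{y_v}} = |K_{y_v}*|` (`logValueGroup`; Def. 5.14.2: «this value group is naturally isomorphic to the value group of its
tilt» `L̂^♭_v`) with the perfection = divisible hull of `L_v*/𝒪*_{L_v} = |L_v*|` read through `ι_{y_v}` — in log-coordinates
`log|K_{y_v}*| = ℚ·log|ι_{y_v}(L_v*)|`; the structure maps `L* → (·)^gp` then agree by construction (`x ↦ |ι_{y_v}(x)|`, `divArith`). This is
also the reading of seat E-t37's handed-over draft (`HOME/staging/E/t37/Arithmeticoids2Draft.lean`). WHY v1 IS DEPRECATED: `Prop5151` asks for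
an abstract isomorphism `PhiArithGp y ≃+ PhiLgpPf` over ALL places, but `PhiLgpPf` has zero archimedean coordinates while `PhiArithGp y` carries
the archimedean value groups (all of `ℝ` for `K_v ≅ (ℂ, |−|^s)`), so v1 fails for cardinality reasons that are an artefact of the typing, not
of print (whose `⊕_{v ∈ V_L}` treats archimedean `v` alike on both sides). [claim: Joshi2023ATS2half, status: disputed] -/
@[claim "Joshi2023ATS2half" "disputed"]
def Prop5151v2 : Prop :=
  D.IsDef411 → ∀ (y : D.Arith) (v : V), v ∉ D.Varc →
    (D.logValueGroup y v : Set ℝ) =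
      {r | ∃ (x : (Lv v)ˣ) (q : ℚ), r = (q : ℝ) * Real.log (D.absK v (y v) (D.emb v (y v) (x : Lv v)))}

attribute [deprecated Prop5151v2 (since := "2026-08-26")] Prop5151

end DeformationDatum

end Summit.ABC.IUTFork.Joshi.ATS2h
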